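import Literature.NumberTheory.DiophantineGeometry.BertiniBadPlaneCountProofs
import Literature.NumberTheory.DiophantineGeometry.BertiniSmallDegreeCertificateProofs
import Literature.NumberTheory.DiophantineGeometry.PlaneSectionBookkeepingProofs
import Literature.NumberTheory.DiophantineGeometry.CafureMateraThm52AssemblyProofs
import HarnessLib

/-!
# Cafure–Matera (2006), Theorem 5.2: PROVED (`CafureMatera2006_thm52_holds`)

Let `K = 𝔽_q`, `f ∈ K[X₁, …, Xₙ]` absolutely irreducible of degree `δ ≥ 2`, and for a triple
`φ = (p, v, w) ∈ (Kⁿ)³` let `f_φ = f(p + Xv + Yw) ∈ K[X][Y]` (outer variable `Y` along `w`) and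
`m(φ)` the number of distinct irreducible factors of `f_φ` over `K`. This file supplies the effective
Bertini input left open by `CafureMateraThm52AssemblyProofs` and discharges the named fact
`CafureMatera2006_thm52` (`CafureMatera.lean`):

1. **Cor. 3.4, parametrised** (`card_filter_exists_smallFactor_planeSection_le`): for `D + 1 ≤ δ`,
   the number of `(p, v, w)` for which `f_φ` has a non-unit factor `u` with `deg_Y u ≤ D` and
   `Y`-coefficients of `X`-degree `≤ D` (in particular an irreducible factor of total degree `≤ D`)
   is at most `((δ + 1) + (2δ - 1)δ + δ (D+1)² (2Dδ)) q^{n-1} q^{2n}`: sort by the direction `w`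
   (bad: `f_δ(w) = 0` or `D_w f = 0`), by the base point `p` (bad for good `w`: `f(p + Tw)` not
   coprime to its derivative), and for good `(p, w)` the bad `v` are zeros of the certificate `Υ_D`
   of `BertiniSmallDegreeCertificateProofs` (Thm. 3.3); the generic three-class count is
   `card_filter_le_of_good_fibres`.
2. **Prop. 4.1, parametrised** (`sum_bad_weight_le_T`): for every `r ≥ 1`,
   `∑_{φ bad} max(1, m(φ) - 1) ≤ T(δ, r) q^{n-1} q^{2n}`,
   `T(δ, r) = r c₃₂(δ) + ∑_{j=r+1}^{δ-1} c₃₄(δ, ⌊δ/(j+1)⌋)`, with `c₃₂(δ) = (δ+1) + (2δ-1)δ + δ²(2δ²-δ)`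
   the constant of the parametrised Cor. 3.2 (`BertiniBadPlaneCountProofs`) and
   `c₃₄(δ, D) = (δ+1) + (2δ-1)δ + δ(D+1)²(2Dδ)`. As in the printed proof:
   `max(1, m - 1) ≤ 1 + #{2 ≤ j < δ : m ≥ j + 1}`, the planes with `m ≥ j + 1`, `j ≤ r`, are
   counted by Cor. 3.2, and a section with `m ≥ j + 1` distinct irreducible factors has one of
   total degree `≤ ⌊δ/(j+1)⌋` (`exists_smallFactor_of_card_normalizedFactors`), counted by Cor. 3.4.
3. **Numerics** (`numeric_prop41`): with `r = ⌊δ^{1/3}⌋`, `δ³ + δ² + 1 + T(δ, r) ≤ 5 δ^{13/3}` for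
   `δ ≥ 6` (`δ = 6, 7` by evaluation, `T = 4901, 8385`; `δ ≥ 8` from
   `∑_{j>r} (j+1)^{-3} ≤ 1/(2(r+1)(r+2))`, `∑_{j>r} (j+1)^{-2} ≤ 1/(r+1)`, `r ≤ δ^{1/3} < r + 1`, and
   `3y¹³ + 6y¹¹ + 3y⁹ + 2y⁷ + y⁶ + y³ + y + 1 ≤ 5y¹³` for `y = δ^{1/3} ≥ 2`).
4. **Theorem 5.2** (`CafureMatera2006_thm52_holds'`, `CafureMatera2006_thm52_holds`): `δ ≤ 5` by
   `CafureMatera2006_thm52_of_totalDegree_le_five`, `δ ≥ 6` by `CafureMatera2006_thm52_of_bad_le`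
   with items 2–3.

Constants: the printed `(2δ^{13/3} + 3δ^{11/3}) q^{3n-3}/(q³(q-1))` of Prop. 4.1 (unparametrised
planes, Kaltofen's sharper `3δ⁴/2 - 2δ³ + 5δ²/2` and the printed degree of `Ψ_D`) becomes
`T(δ, ⌊δ^{1/3}⌋) q^{3n-1} ≤ (3δ^{13/3} + 6δ^{11/3} + 2δ³ + 2δ^{7/3} + δ + δ^{1/3}) q^{3n-1}`, which the
parametrised averaging (no factor `4/3`, no `D`-term) absorbs in `5δ^{13/3}`.

No definitions, no new named facts.

## References

* A. Cafure, G. Matera, *Improved explicit estimates on the number of solutions of equations over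
  a finite field*, Finite Fields Appl. 12 (2006) 155–185, §3.2 (Thm. 3.3, Cor. 3.4), §4 ((11)–(15),
  Prop. 4.1), §5.1 ((21)–(23), Thm. 5.2). [CafureMatera2006]
* E. Kaltofen, *Effective Noether irreducibility forms and applications*, J. Comput. System Sci.
  50 (1995) 274–295, Thm. 5. [Kaltofen1995]
-/

noncomputable section

/-! ## Part 1: Cor. 3.4, parametrised -/

open scoped Classical Polynomial Polynomial.Bivariate
open Polynomial

namespace Literature.NumberTheory.DiophantineGeometry

universe u v

variable {K : Type u} [Field K] {n : ℕ}

/-- The plane section `f(p + Xv + Yw) ∈ K[X][Y]` (local notation). -/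
local notation3 (prettyPrint := false) "sec[" f ", " p ", " v ", " w "]" =>
  (MvPolynomial.aeval (R := K) (fun i ↦ Polynomial.C (Polynomial.C (w i)) * Polynomial.X +
      Polynomial.C (Polynomial.C (p i) + Polynomial.C (v i) * Polynomial.X)) f)

/-! ### Degree of a non-unit factor of a section with constant leading coefficient -/

omit [Field K] in
/-- A non-unit factor of a bivariate polynomial with nonzero constant leading `Y`-coefficient has
positive `Y`-degree. [folklore] -/
theorem natDegree_pos_of_dvd_of_leadingCoeff_eq_C {K : Type u} [Field K] {P u : K[X][Y]} {c : K}
    (hc : c ≠ 0) (hlead : P.leadingCoeff = C c) (hu : u ∣ P) (hnu : ¬ IsUnit u) :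
    1 ≤ u.natDegree := by
  obtain ⟨t, rfl⟩ := hu
  have hlc : u.leadingCoeff * t.leadingCoeff = C c := by rw [← leadingCoeff_mul, hlead]
  have huu : IsUnit u.leadingCoeff := isUnit_iff_exists_inv.2 ⟨t.leadingCoeff * C c⁻¹, by
    rw [← mul_assoc, hlc, ← C_mul, mul_inv_cancel₀ hc, C_1]⟩
  by_contra h0
  rw [not_le, Nat.lt_one_iff] at h0
  apply hnu
  rw [eq_C_of_natDegree_eq_zero h0]
  refine isUnit_C.2 ?_
  have : u.leadingCoeff = u.coeff 0 := by rw [leadingCoeff, h0]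
  rwa [← this]

variable [Fintype K]

/-! ### The generic three-class count -/

/-- **Counting bad triples `(p, v, w)` through good fibres.** If for every good pair `(p, w)`
(`f_δ(w) ≠ 0` and `f(p + Tw)` coprime to its derivative) at most `N q^{n-1}` values of `v` are bad,
then at most `((δ + 1) + (2δ - 1)δ + N) q^{n-1} q^{2n}` triples are bad (`f` absolutely irreducible
of degree `δ`). [cite: CafureMatera2006, §3.2] -/
theorem card_filter_le_of_good_fibres {f : MvPolynomial (Fin n) K} (hf : IsAbsIrreducible f)
    (Bad : (Fin n → K) → (Fin n → K) → (Fin n → K) → Prop) (N : ℕ)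
    (hfib : ∀ p w : Fin n → K,
      MvPolynomial.eval w (MvPolynomial.homogeneousComponent f.totalDegree f) ≠ 0 →
      IsCoprime
        (MvPolynomial.aeval
          (fun i ↦ Polynomial.C (p i) + Polynomial.C (w i) * Polynomial.X : Fin n → K[X]) f)
        (Polynomial.derivative (MvPolynomial.aeval
          (fun i ↦ Polynomial.C (p i) + Polynomial.C (w i) * Polynomial.X : Fin n → K[X]) f)) →
      (Finset.univ.filter fun v : Fin n → K ↦ Bad p v w).card ≤ N * Fintype.card K ^ (n - 1)) :
    (Finset.univ.filter fun φ : (Fin n → K) × (Fin n → K) × (Fin n → K) ↦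
        Bad φ.1 φ.2.1 φ.2.2).card ≤
      ((f.totalDegree + 1) + (f.totalDegree + (f.totalDegree - 1)) * f.totalDegree + N) *
        Fintype.card K ^ (n - 1) * (Fintype.card K ^ n * Fintype.card K ^ n) := by
  set Kbar := AlgebraicClosure K with hKbar
  set σ : K →+* Kbar := algebraMap K Kbar with hσ
  have hf' : Irreducible (MvPolynomial.map σ f) := hf
  set δ := f.totalDegree with hδ
  set q := Fintype.card K with hq
  have hirrK : Irreducible f := irreducible_of_irreducible_mvPolynomial_map σ hf'
  have hδ1 : 1 ≤ δ := hf.totalDegree_pos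
  have hf0 : f ≠ 0 := hf.ne_zero
  -- some partial derivative is non-zero
  obtain ⟨i₀, hi₀⟩ := exists_pderiv_ne_zero hf'
  rw [MvPolynomial.pderiv_map] at hi₀
  have hi₀' : MvPolynomial.pderiv i₀ f ≠ 0 := fun h ↦ hi₀ (by rw [h, map_zero])
  -- the three classes
  set badW : Finset (Fin n → K) := Finset.univ.filter fun w ↦
    MvPolynomial.eval w (MvPolynomial.homogeneousComponent δ f) = 0 ∨
      (∑ i, MvPolynomial.C (w i) * MvPolynomial.pderiv i f) = 0 with hbadW
  set res : (Fin n → K) → MvPolynomial (Fin n) K := fun w ↦ Polynomial.resultant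
      (MvPolynomial.aeval
        (fun i ↦ Polynomial.C (MvPolynomial.X i) + Polynomial.C (MvPolynomial.C (w i)) * Polynomial.X :
          Fin n → Polynomial (MvPolynomial (Fin n) K)) f)
      (Polynomial.derivative (MvPolynomial.aeval
        (fun i ↦ Polynomial.C (MvPolynomial.X i) + Polynomial.C (MvPolynomial.C (w i)) * Polynomial.X :
          Fin n → Polynomial (MvPolynomial (Fin n) K)) f))
      δ (δ - 1) with hres
  set A := Finset.univ.filter fun φ : (Fin n → K) × (Fin n → K) × (Fin n → K) ↦ φ.2.2 ∈ badW
    with hA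
  set B := Finset.univ.filter fun φ : (Fin n → K) × (Fin n → K) × (Fin n → K) ↦
    φ.2.2 ∉ badW ∧ MvPolynomial.eval φ.1 (res φ.2.2) = 0 with hB
  set Cc := Finset.univ.filter fun φ : (Fin n → K) × (Fin n → K) × (Fin n → K) ↦
    φ.2.2 ∉ badW ∧ MvPolynomial.eval φ.1 (res φ.2.2) ≠ 0 ∧ Bad φ.1 φ.2.1 φ.2.2 with hCc
  have hsub : (Finset.univ.filter fun φ : (Fin n → K) × (Fin n → K) × (Fin n → K) ↦
      Bad φ.1 φ.2.1 φ.2.2) ⊆ A ∪ B ∪ Cc := by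
    intro φ hφ
    have hφ' := (Finset.mem_filter.1 hφ).2
    by_cases hw : φ.2.2 ∈ badW
    · exact Finset.mem_union.2 (Or.inl (Finset.mem_union.2 (Or.inl
        (Finset.mem_filter.2 ⟨Finset.mem_univ _, hw⟩))))
    · by_cases hp : MvPolynomial.eval φ.1 (res φ.2.2) = 0
      · exact Finset.mem_union.2 (Or.inl (Finset.mem_union.2 (Or.inr
          (Finset.mem_filter.2 ⟨Finset.mem_univ _, hw, hp⟩))))
      · exact Finset.mem_union.2 (Or.inr (Finset.mem_filter.2 ⟨Finset.mem_univ _, hw, hp, hφ'⟩))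
  -- (i) the bad directions
  have hAcard : A.card ≤ (δ + 1) * q ^ (n - 1) * (q ^ n * q ^ n) := by
    have hbadW : badW.card ≤ (δ + 1) * q ^ (n - 1) := card_filter_badDirection_le hf0 hi₀'
    have : A = (Finset.univ : Finset (Fin n → K)) ×ˢ ((Finset.univ : Finset (Fin n → K)) ×ˢ badW) := by
      ext φ
      simp [hA]
    rw [this, Finset.card_product, Finset.card_product, Finset.card_univ, Fintype.card_fun,
      Fintype.card_fin, ← hq]
    calc q ^ n * (q ^ n * badW.card) = badW.card * (q ^ n * q ^ n) := by ring
      _ ≤ (δ + 1) * q ^ (n - 1) * (q ^ n * q ^ n) := Nat.mul_le_mul_right _ hbadW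
  -- (ii) the bad base points
  have hBcard : B.card ≤ (δ + (δ - 1)) * δ * q ^ (n - 1) * (q ^ n * q ^ n) := by
    have hfib' : ∀ w : Fin n → K, w ∉ badW →
        (Finset.univ.filter fun p : Fin n → K ↦ MvPolynomial.eval p (res w) = 0).card ≤
          (δ + (δ - 1)) * δ * q ^ (n - 1) := by
      intro w hw
      rw [hbadW, Finset.mem_filter, not_and, not_or] at hw
      obtain ⟨hv, hD⟩ := hw (Finset.mem_univ w)
      have hres0 : res w ≠ 0 := resultant_lineRestrict_derivative_ne_zero hirrK hv hD
      have hresdeg : (res w).totalDegree ≤ (δ + (δ - 1)) * δ :=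
        totalDegree_resultant_lineRestrict_le f w
      exact (rationalPointCount_le_totalDegree_mul hres0).trans (Nat.mul_le_mul_right _ hresdeg)
    rw [Finset.card_eq_sum_card_fiberwise (f := fun φ : (Fin n → K) × (Fin n → K) × (Fin n → K) ↦ φ.2)
      (t := Finset.univ) fun _ _ ↦ Finset.mem_univ _]
    calc ∑ vw : (Fin n → K) × (Fin n → K), (B.filter fun φ ↦ φ.2 = vw).card
        ≤ ∑ _vw : (Fin n → K) × (Fin n → K), (δ + (δ - 1)) * δ * q ^ (n - 1) := by
          refine Finset.sum_le_sum fun vw _ ↦ ?_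
          rcases vw with ⟨v, w⟩
          by_cases hw : w ∈ badW
          · rw [Finset.filter_false_of_mem, Finset.card_empty]
            · exact Nat.zero_le _
            · intro φ hφ heq
              rw [hB, Finset.mem_filter] at hφ
              rw [heq] at hφ
              exact hφ.2.1 hw
          · refine le_trans ?_ (hfib' w hw)
            refine Finset.card_le_card_of_injOn (fun φ ↦ φ.1) (fun φ hφ ↦ ?_) (fun φ₁ h₁ φ₂ h₂ h ↦ ?_)
            · rw [Finset.mem_coe, Finset.mem_filter, hB, Finset.mem_filter] at hφ
              obtain ⟨⟨-, -, hp⟩, heq⟩ := hφ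
              rw [heq] at hp
              rw [Finset.mem_coe, Finset.mem_filter]
              exact ⟨Finset.mem_univ _, hp⟩
            · rw [Finset.mem_coe, Finset.mem_filter] at h₁ h₂
              exact Prod.ext h (h₁.2.trans h₂.2.symm)
      _ = (δ + (δ - 1)) * δ * q ^ (n - 1) * (q ^ n * q ^ n) := by
          rw [Finset.sum_const, Finset.card_univ, Fintype.card_prod, Fintype.card_fun,
            Fintype.card_fin, smul_eq_mul, ← hq]
          ring
  -- (iii) the bad `v` for good `(p, w)`
  have hCcard : Cc.card ≤ N * q ^ (n - 1) * (q ^ n * q ^ n) := by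
    have hfib'' : ∀ pw : (Fin n → K) × (Fin n → K), pw.2 ∉ badW →
        MvPolynomial.eval pw.1 (res pw.2) ≠ 0 →
        (Finset.univ.filter fun v : Fin n → K ↦ Bad pw.1 v pw.2).card ≤ N * q ^ (n - 1) := by
      intro pw hw hp
      rw [hbadW, Finset.mem_filter, not_and, not_or] at hw
      obtain ⟨hv, -⟩ := hw (Finset.mem_univ _)
      exact hfib pw.1 pw.2 hv (isCoprime_lineSpecialization_of_eval_ne_zero hδ1 pw.2 pw.1 hp)
    rw [Finset.card_eq_sum_card_fiberwise
      (f := fun φ : (Fin n → K) × (Fin n → K) × (Fin n → K) ↦ (φ.1, φ.2.2))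
      (t := Finset.univ) fun _ _ ↦ Finset.mem_univ _]
    calc ∑ pw : (Fin n → K) × (Fin n → K), (Cc.filter fun φ ↦ (φ.1, φ.2.2) = pw).card
        ≤ ∑ _pw : (Fin n → K) × (Fin n → K), N * q ^ (n - 1) := by
          refine Finset.sum_le_sum fun pw _ ↦ ?_
          rcases pw with ⟨p, w⟩
          by_cases hw : w ∈ badW
          · rw [Finset.filter_false_of_mem, Finset.card_empty]
            · exact Nat.zero_le _
            · intro φ hφ heq
              rw [hCc, Finset.mem_filter] at hφ
              rw [Prod.mk.injEq] at heq
              rw [heq.2] at hφ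
              exact hφ.2.1 hw
          by_cases hp : MvPolynomial.eval p (res w) = 0
          · rw [Finset.filter_false_of_mem, Finset.card_empty]
            · exact Nat.zero_le _
            · intro φ hφ heq
              rw [hCc, Finset.mem_filter] at hφ
              rw [Prod.mk.injEq] at heq
              rw [heq.1, heq.2] at hφ
              exact hφ.2.2.1 hp
          · refine le_trans ?_ (hfib'' (p, w) hw hp)
            refine Finset.card_le_card_of_injOn (fun φ ↦ φ.2.1) (fun φ hφ ↦ ?_)
              (fun φ₁ h₁ φ₂ h₂ h ↦ ?_)
            · rw [Finset.mem_coe, Finset.mem_filter, hCc, Finset.mem_filter] at hφ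
              obtain ⟨⟨-, -, -, hbad⟩, heq⟩ := hφ
              rw [Prod.mk.injEq] at heq
              rw [heq.1, heq.2] at hbad
              rw [Finset.mem_coe, Finset.mem_filter]
              exact ⟨Finset.mem_univ _, hbad⟩
            · rw [Finset.mem_coe, Finset.mem_filter, Prod.mk.injEq] at h₁ h₂
              exact Prod.ext (h₁.2.1.trans h₂.2.1.symm)
                (Prod.ext h (h₁.2.2.trans h₂.2.2.symm))
      _ = N * q ^ (n - 1) * (q ^ n * q ^ n) := by
          rw [Finset.sum_const, Finset.card_univ, Fintype.card_prod, Fintype.card_fun,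
            Fintype.card_fin, smul_eq_mul, ← hq]
          ring
  calc _ ≤ (A ∪ B ∪ Cc).card := Finset.card_le_card hsub
    _ ≤ A.card + B.card + Cc.card :=
        (Finset.card_union_le _ _).trans (Nat.add_le_add_right (Finset.card_union_le _ _) _)
    _ ≤ (δ + 1) * q ^ (n - 1) * (q ^ n * q ^ n) + (δ + (δ - 1)) * δ * q ^ (n - 1) * (q ^ n * q ^ n) +
          N * q ^ (n - 1) * (q ^ n * q ^ n) :=
        Nat.add_le_add (Nat.add_le_add hAcard hBcard) hCcard
    _ = _ := by ring

/-! ### The bad `X`-directions for a good pair `(p, w)`: the certificate `Υ_D` -/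

/-- **For a good pair `(p, w)`, at most `δ (D+1)² (2Dδ) q^{n-1}` directions `v` give a section
`f(p + Xv + Yw)` with a non-unit factor of `Y`-degree `≤ D` and `Y`-coefficients of `X`-degree
`≤ D`** (the certificate `Υ_D` of the generic plane section through the line `p + Tw`,
specialised at the `K`-rational `v`). [cite: CafureMatera2006, Thm. 3.3, Cor. 3.4] -/
theorem card_filter_exists_smallFactor_le_of_good {f : MvPolynomial (Fin n) K}
    (hf : IsAbsIrreducible f) {D : ℕ} (hDδ : D + 1 ≤ f.totalDegree) {w : Fin n → K}
    (hv : MvPolynomial.eval w (MvPolynomial.homogeneousComponent f.totalDegree f) ≠ 0)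
    {p : Fin n → K}
    (hcop : IsCoprime
      (MvPolynomial.aeval
        (fun i ↦ Polynomial.C (p i) + Polynomial.C (w i) * Polynomial.X : Fin n → K[X]) f)
      (Polynomial.derivative (MvPolynomial.aeval
        (fun i ↦ Polynomial.C (p i) + Polynomial.C (w i) * Polynomial.X : Fin n → K[X]) f))) :
    (Finset.univ.filter fun v : Fin n → K ↦
        ∃ u : K[X][Y], u ∣ sec[f, p, v, w] ∧ ¬ IsUnit u ∧ u.natDegree ≤ D ∧
          ∀ e, (u.coeff e).natDegree ≤ D).card ≤
      f.totalDegree * ((D + 1) ^ 2 * (2 * D * f.totalDegree)) * Fintype.card K ^ (n - 1) := by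
  set Kbar := AlgebraicClosure K with hKbar
  set σ : K →+* Kbar := algebraMap K Kbar with hσ
  have hf' : Irreducible (MvPolynomial.map σ f) := hf
  set δ := f.totalDegree with hδ
  have hδ1 : 1 ≤ δ := hf.totalDegree_pos
  -- the univariate restriction `g = f(p + Tw)`
  set g : K[X] := MvPolynomial.aeval
    (fun i ↦ Polynomial.C (p i) + Polynomial.C (w i) * Polynomial.X : Fin n → K[X]) f with hg
  have hgcoeff : g.coeff δ =
      MvPolynomial.eval w (MvPolynomial.homogeneousComponent δ f) :=
    coeff_map_eval_lineRestrict_totalDegree f p w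
  have hgdegle : g.natDegree ≤ δ := natDegree_map_eval_lineRestrict_le f p w
  have hgdeg : g.natDegree = δ :=
    le_antisymm hgdegle (le_natDegree_of_ne_zero (by rw [hgcoeff]; exact hv))
  have hg0 : g ≠ 0 := fun h ↦ by rw [h, natDegree_zero] at hgdeg; omega
  have hsep : (g.map σ).Separable := Polynomial.Separable.map hcop
  -- the generic plane section `χ` over `K̄` and its shape
  set μ' : Fin n → Kbar := σ ∘ p with hμ'
  set v' : Fin n → Kbar := σ ∘ w with hv'
  have hFdeg : (MvPolynomial.map σ f).totalDegree = δ := totalDegree_map_of_injective f σ.injective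
  have hgbar : MvPolynomial.aeval (fun i ↦ C (μ' i) + C (v' i) * X : Fin n → Kbar[X])
      (MvPolynomial.map σ f) = g.map σ := aeval_affine_map_eq σ f p w hμ' hv'
  have hgbar0 : MvPolynomial.aeval (fun i ↦ C (μ' i) + C (v' i) * X : Fin n → Kbar[X])
      (MvPolynomial.map σ f) ≠ 0 := by
    rw [hgbar]
    exact (Polynomial.map_ne_zero_iff σ.injective).2 hg0
  have hirrχ := irreducible_planeSubst hf' μ' v' hgbar0
  have hdegle := natDegree_planeSubst_le (MvPolynomial.map σ f) μ' v'
  have hcoeff := coeff_planeSubst_totalDegree (MvPolynomial.map σ f) μ' v'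
  have htd := coeff_coeff_planeSubst_eq_zero (MvPolynomial.map σ f) μ' v'
  have hfil := filtration_planeSubst (MvPolynomial.map σ f) μ' v'
  have hred := map_evalRingHom_zero_planeSubst (MvPolynomial.map σ f) μ' v'
  rw [hFdeg] at hdegle hcoeff htd
  rw [hgbar] at hred
  set c := MvPolynomial.eval w (MvPolynomial.homogeneousComponent δ f) with hc
  have hcbar : MvPolynomial.eval v' (MvPolynomial.homogeneousComponent δ (MvPolynomial.map σ f)) =
      σ c := by
    rw [homogeneousComponent_map, MvPolynomial.eval_map, hv', hc]
    show MvPolynomial.eval₂ σ (σ ∘ w) _ = σ (MvPolynomial.eval₂ (RingHom.id K) w _)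
    rw [MvPolynomial.eval₂_comp_left σ (RingHom.id K) w, RingHom.comp_id]
  have hσc : σ c ≠ 0 := (map_ne_zero σ).2 hv
  rw [hcbar] at hcoeff
  have hdegχ := le_antisymm hdegle (le_natDegree_of_ne_zero (by
    rw [hcoeff]
    exact Polynomial.C_ne_zero.2 (MvPolynomial.C_ne_zero.2 hσc)))
  have hleadχ := hcoeff
  rw [← hdegχ, coeff_natDegree] at hleadχ
  -- the certificate `Υ_D`
  obtain ⟨Υ, hΥ0, hΥdeg, hΥ⟩ :=
    exists_noSmallFactor_certificate hDδ hdegχ hσc hleadχ hirrχ htd hfil hred hsep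
  -- the section over `K`: degree `δ`, leading coefficient `C c`
  have hsecdeg : ∀ v : Fin n → K, (sec[f, p, v, w]).natDegree = δ ∧
      (sec[f, p, v, w]).leadingCoeff = C c := by
    intro v
    have h1 := natDegree_aeval_affine_le f w (fun i ↦ C (p i) + C (v i) * X)
      (fun i ↦ (natDegree_add_le _ _).trans
        (max_le (by simp) ((natDegree_C_mul_le _ _).trans natDegree_X_le)))
    have h2 := coeff_aeval_affine_totalDegree f w (fun i ↦ C (p i) + C (v i) * X)
    rw [← hδ] at h1 h2
    have h3 : (sec[f, p, v, w]).natDegree = δ :=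
      le_antisymm h1 (le_natDegree_of_ne_zero (by rw [h2, ← hc]; exact C_ne_zero.2 hv))
    refine ⟨h3, ?_⟩
    rw [leadingCoeff, h3, h2, ← hc]
  -- the bad `v` are roots of `Υ(σ v)`
  calc (Finset.univ.filter fun v : Fin n → K ↦
          ∃ u : K[X][Y], u ∣ sec[f, p, v, w] ∧ ¬ IsUnit u ∧ u.natDegree ≤ D ∧
            ∀ e, (u.coeff e).natDegree ≤ D).card
      ≤ (Finset.univ.filter fun v : Fin n → K ↦ MvPolynomial.eval (σ ∘ v) Υ = 0).card := by
        refine Finset.card_le_card fun v hvmem ↦ ?_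
        rw [Finset.mem_filter] at hvmem ⊢
        refine ⟨Finset.mem_univ _, ?_⟩
        obtain ⟨u, hu, hnu, huD, huc⟩ := hvmem.2
        by_contra hne
        obtain ⟨t, ht⟩ := hu
        have h1 : 1 ≤ u.natDegree :=
          natDegree_pos_of_dvd_of_leadingCoeff_eq_C hv (hsecdeg v).2 ⟨t, ht⟩ hnu
        refine hΥ (σ ∘ v) hne (u.map (mapRingHom σ)) (t.map (mapRingHom σ)) ?_ ?_ ?_ ?_
        · rw [map_planeSubst_eval_eq σ f p w v hμ' hv', ← Polynomial.map_mul, ← ht]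
        · rwa [natDegree_map_eq_of_injective (map_injective σ σ.injective)]
        · rwa [natDegree_map_eq_of_injective (map_injective σ σ.injective)]
        · intro e
          rw [coeff_map, coe_mapRingHom]
          exact natDegree_map_le.trans (huc e)
    _ ≤ Υ.totalDegree * Fintype.card K ^ (n - 1) := card_filter_eval_comp_eq_zero_le_of_ne_zero σ hΥ0
    _ ≤ δ * ((D + 1) ^ 2 * (2 * D * δ)) * Fintype.card K ^ (n - 1) :=
        Nat.mul_le_mul_right _ hΥdeg

/-! ### The count -/

/-- **Cafure–Matera Cor. 3.4, parametrised: few plane sections have a factor of degree `≤ D`.**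
For `f ∈ 𝔽_q[X₁, …, Xₙ]` absolutely irreducible of degree `δ` and `D + 1 ≤ δ`, the number of
`(p, v, w) ∈ (𝔽_qⁿ)³` whose section `f(p + Xv + Yw) ∈ 𝔽_q[X][Y]` has a non-unit factor `u` with
`deg_Y u ≤ D` and `Y`-coefficients of `X`-degree `≤ D` is at most
`((δ + 1) + (2δ - 1)δ + δ (D+1)² (2Dδ)) q^{n-1} q^{2n}`.
[cite: CafureMatera2006, Cor. 3.4] [cite: Kaltofen1995, Thm. 5] -/
theorem card_filter_exists_smallFactor_planeSection_le {f : MvPolynomial (Fin n) K}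
    (hf : IsAbsIrreducible f) {D : ℕ} (hDδ : D + 1 ≤ f.totalDegree) :
    (Finset.univ.filter fun φ : (Fin n → K) × (Fin n → K) × (Fin n → K) ↦
        ∃ u : K[X][Y], u ∣ sec[f, φ.1, φ.2.1, φ.2.2] ∧ ¬ IsUnit u ∧ u.natDegree ≤ D ∧
          ∀ e, (u.coeff e).natDegree ≤ D).card ≤
      ((f.totalDegree + 1) + (f.totalDegree + (f.totalDegree - 1)) * f.totalDegree +
          f.totalDegree * ((D + 1) ^ 2 * (2 * D * f.totalDegree))) *
        Fintype.card K ^ (n - 1) * (Fintype.card K ^ n * Fintype.card K ^ n) :=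
  card_filter_le_of_good_fibres hf
    (fun p v w ↦ ∃ u : K[X][Y], u ∣ sec[f, p, v, w] ∧ ¬ IsUnit u ∧ u.natDegree ≤ D ∧
      ∀ e, (u.coeff e).natDegree ≤ D) _
    fun _ _ hv hcop ↦ card_filter_exists_smallFactor_le_of_good hf hDδ hv hcop

end Literature.NumberTheory.DiophantineGeometry

/-! ## Part 2: Prop. 4.1, parametrised; numerics; Theorem 5.2 -/

open scoped Classical Polynomial Polynomial.Bivariate
open Polynomial

namespace Literature.NumberTheory.DiophantineGeometry

universe u

/-- The plane section `f(p + Xv + Yw) ∈ K[X][Y]` (local notation, as in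
`CafureMateraThm52AssemblyProofs`). -/
local notation3 (prettyPrint := false) "sec[" K ", " f ", " p ", " v ", " w "]" =>
  (MvPolynomial.aeval (R := K) (fun i ↦ Polynomial.C (Polynomial.C (w i)) * Polynomial.X +
      Polynomial.C (Polynomial.C (p i) + Polynomial.C (v i) * Polynomial.X)) f)

/-! ### The weights `max(1, m - 1)` -/

/-- `max(1, m - 1) ≤ 1 + #{2 ≤ j < δ : j + 1 ≤ m}` for `m ≤ δ`. [cite: CafureMatera2006, §4] -/
theorem max_one_sub_one_le_one_add_card {m δ : ℕ} (hm : m ≤ δ) :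
    max 1 (m - 1) ≤ 1 + ((Finset.Ico 2 δ).filter fun j ↦ j + 1 ≤ m).card := by
  rcases le_or_gt m 2 with h2 | h2
  · calc max 1 (m - 1) = 1 := by omega
      _ ≤ _ := Nat.le_add_right _ _
  · have hsub : Finset.Ico 2 m ⊆ (Finset.Ico 2 δ).filter fun j ↦ j + 1 ≤ m := by
      intro j hj
      rw [Finset.mem_Ico] at hj
      rw [Finset.mem_filter, Finset.mem_Ico]
      omega
    have := Finset.card_le_card hsub
    rw [Nat.card_Ico] at this
    omega

/-! ### A section with many factors has a small factor -/

section SmallFactor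

variable {K : Type u} [Field K]

/-- **Many distinct irreducible factors force a factor of small degree:** if `P ∈ K[X][Y]`,
`P ≠ 0`, has weighted (total) degree `≤ δ` and at least `j + 1` distinct normalised irreducible
factors, then it has a non-unit factor `u` with `deg_Y u ≤ ⌊δ/(j+1)⌋` and `Y`-coefficients of
`X`-degree `≤ ⌊δ/(j+1)⌋`. [cite: CafureMatera2006, §4 ("f_L has an absolutely irreducible factor
of degree at most D_j")] -/
theorem exists_smallFactor_of_card_normalizedFactors {P : K[X][Y]} (hP0 : P ≠ 0) {δ j : ℕ}
    (hW : (P.support.sup fun k ↦ (P.coeff k).natDegree + k) ≤ δ)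
    (hm : j + 1 ≤ (UniqueFactorizationMonoid.normalizedFactors P).toFinset.card) :
    ∃ u : K[X][Y], u ∣ P ∧ ¬ IsUnit u ∧ u.natDegree ≤ δ / (j + 1) ∧
      ∀ e, (u.coeff e).natDegree ≤ δ / (j + 1) := by
  set S := (UniqueFactorizationMonoid.normalizedFactors P).toFinset with hS
  have hmem : ∀ u ∈ S, u ∈ UniqueFactorizationMonoid.normalizedFactors P := fun u hu ↦
    Multiset.mem_toFinset.1 hu
  have hirr : ∀ u ∈ S, Irreducible u := fun u hu ↦
    UniqueFactorizationMonoid.irreducible_of_normalized_factor u (hmem u hu)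
  have hne : ∀ u ∈ S, u ≠ 0 := fun u hu ↦ (hirr u hu).ne_zero
  have hdvd : ∏ u ∈ S, u ∣ P := by
    have h1 : ∏ u ∈ S, u = (UniqueFactorizationMonoid.normalizedFactors P).dedup.prod := by
      rw [Finset.prod_eq_multiset_prod, hS, Multiset.toFinset_val, Multiset.map_id']
    rw [h1]
    exact dvd_trans (Multiset.prod_dvd_prod_of_le (Multiset.dedup_le _))
      (UniqueFactorizationMonoid.prod_normalizedFactors hP0).dvd
  have hsum : ∑ u ∈ S, (u.support.sup fun k ↦ (u.coeff k).natDegree + k) ≤ δ := by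
    calc ∑ u ∈ S, (u.support.sup fun k ↦ (u.coeff k).natDegree + k)
        = (∏ u ∈ S, u).support.sup fun k ↦ ((∏ u ∈ S, u).coeff k).natDegree + k :=
          (PlaneShear.sup_support_prod S id hne).symm
      _ ≤ P.support.sup fun k ↦ (P.coeff k).natDegree + k :=
          PlaneShear.sup_support_le_of_dvd hdvd hP0
      _ ≤ δ := hW
  -- some factor has weighted degree `≤ δ/(j+1)`
  obtain ⟨u, huS, huW⟩ : ∃ u ∈ S, (u.support.sup fun k ↦ (u.coeff k).natDegree + k) ≤
      δ / (j + 1) := by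
    by_contra hall
    push Not at hall
    have h1 : S.card * (δ / (j + 1) + 1) ≤
        ∑ u ∈ S, (u.support.sup fun k ↦ (u.coeff k).natDegree + k) := by
      rw [Finset.card_eq_sum_ones, Finset.sum_mul, one_mul]
      exact Finset.sum_le_sum fun u hu ↦ hall u hu
    have h2 : (j + 1) * (δ / (j + 1) + 1) ≤ S.card * (δ / (j + 1) + 1) :=
      Nat.mul_le_mul_right _ hm
    have h3 : δ < (j + 1) * (δ / (j + 1) + 1) := Nat.lt_mul_div_succ δ (by omega)
    omega
  have hu0 : u ≠ 0 := hne u huS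
  refine ⟨u, UniqueFactorizationMonoid.dvd_of_mem_normalizedFactors (hmem u huS),
    (hirr u huS).not_isUnit, ?_, fun e ↦ ?_⟩
  · have := PlaneShear.le_sup_support (P := u) (k := u.natDegree)
      (by rw [coeff_natDegree]; exact leadingCoeff_ne_zero.2 hu0)
    exact le_trans (by omega) huW
  · by_cases he : u.coeff e = 0
    · rw [he, natDegree_zero]; exact Nat.zero_le _
    · have := PlaneShear.le_sup_support he
      exact le_trans (by omega) huW

end SmallFactor

/-! ### The weighted bad-plane count `T(δ, r)` -/

section Count

variable {K : Type u} [Field K] [Fintype K] {n : ℕ}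

/-- **Parametrised Prop. 4.1, counting part:** for `f` absolutely irreducible of degree `δ ≥ 2`
and `r ≥ 1`,
`∑_{φ bad} max(1, m(φ) - 1) ≤ (r c₃₂(δ) + ∑_{j=r+1}^{δ-1} c₃₄(δ, ⌊δ/(j+1)⌋)) q^{n-1} q^{2n}`.
[cite: CafureMatera2006, Prop. 4.1, (11), (13), (14)] -/
theorem sum_bad_weight_le_T {f : MvPolynomial (Fin n) K} (hf : IsAbsIrreducible f) {δ : ℕ}
    (hδ : f.totalDegree = δ) (hδ2 : 2 ≤ δ) {r : ℕ} (hr : 1 ≤ r) :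
    (∑ φ ∈ (Finset.univ.filter fun φ : (Fin n → K) × (Fin n → K) × (Fin n → K) ↦
        LinearIndependent K ![φ.2.1, φ.2.2] ∧ sec[K, f, φ.1, φ.2.1, φ.2.2] ≠ 0 ∧
          ¬ Irreducible ((sec[K, f, φ.1, φ.2.1, φ.2.2]).map
            (Polynomial.mapRingHom (algebraMap K (AlgebraicClosure K))))),
      max 1 ((UniqueFactorizationMonoid.normalizedFactors
        (sec[K, f, φ.1, φ.2.1, φ.2.2])).toFinset.card - 1)) ≤
      (r * ((δ + 1) + (δ + (δ - 1)) * δ + δ ^ 2 * (2 * δ ^ 2 - δ)) +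
        ∑ j ∈ Finset.Ico (r + 1) δ,
          ((δ + 1) + (δ + (δ - 1)) * δ + δ * ((δ / (j + 1) + 1) ^ 2 * (2 * (δ / (j + 1)) * δ)))) *
        Fintype.card K ^ (n - 1) * (Fintype.card K ^ n * Fintype.card K ^ n) := by
  set q := Fintype.card K with hq
  set Q := q ^ (n - 1) * (q ^ n * q ^ n) with hQ
  set Bad := Finset.univ.filter fun φ : (Fin n → K) × (Fin n → K) × (Fin n → K) ↦
    LinearIndependent K ![φ.2.1, φ.2.2] ∧ sec[K, f, φ.1, φ.2.1, φ.2.2] ≠ 0 ∧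
      ¬ Irreducible ((sec[K, f, φ.1, φ.2.1, φ.2.2]).map
        (Polynomial.mapRingHom (algebraMap K (AlgebraicClosure K)))) with hBad
  set m : (Fin n → K) × (Fin n → K) × (Fin n → K) → ℕ := fun φ ↦
    (UniqueFactorizationMonoid.normalizedFactors (sec[K, f, φ.1, φ.2.1, φ.2.2])).toFinset.card
    with hm
  set c32 := (δ + 1) + (δ + (δ - 1)) * δ + δ ^ 2 * (2 * δ ^ 2 - δ) with hc32
  set c34 : ℕ → ℕ := fun j ↦
    (δ + 1) + (δ + (δ - 1)) * δ + δ * ((δ / (j + 1) + 1) ^ 2 * (2 * (δ / (j + 1)) * δ)) with hc34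
  -- weighted degree of a section is `≤ δ`
  have hW : ∀ p v w : Fin n → K,
      ((sec[K, f, p, v, w]).support.sup fun k ↦ ((sec[K, f, p, v, w]).coeff k).natDegree + k) ≤ δ := by
    intro p v w
    have hTD := coeff_coeff_planeSection_eq_zero f p v w
    rw [hδ] at hTD
    exact Finset.sup_le fun k hk ↦ PlaneShear.natDegree_coeff_add_le_of_coeff_coeff_eq_zero hTD k
      (Polynomial.mem_support_iff.1 hk)
  have hmle : ∀ φ ∈ Bad, m φ ≤ δ := by
    intro φ hφ
    rw [hBad, Finset.mem_filter] at hφ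
    exact (PlaneShear.card_normalizedFactors_toFinset_le_sup_support hφ.2.2.1).trans (hW _ _ _)
  -- the Cor. 3.2 count
  have hBadcard : Bad.card ≤ c32 * Q := by
    have hcount := card_filter_not_irreducible_planeSection_le hf
    rw [hδ] at hcount
    refine le_trans (Finset.card_le_card fun φ hφ ↦ ?_) (hcount.trans (le_of_eq ?_))
    · rw [hBad, Finset.mem_filter] at hφ
      rw [Finset.mem_filter]
      exact ⟨hφ.1, hφ.2.2.2⟩
    · rw [hc32, hQ, hq]; ring
  -- the Cor. 3.4 counts
  set g : ℕ → ℕ := fun j ↦ (Bad.filter fun φ ↦ j + 1 ≤ m φ).card with hg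
  have hgle : ∀ j, g j ≤ Bad.card := fun j ↦ Finset.card_filter_le _ _
  have hg34 : ∀ j, 2 ≤ j → g j ≤ c34 j * Q := by
    intro j hj
    have hDδ : δ / (j + 1) + 1 ≤ f.totalDegree := by
      rw [hδ]
      have : δ / (j + 1) < δ := Nat.div_lt_self (by omega) (by omega)
      omega
    have hcount := card_filter_exists_smallFactor_planeSection_le hf hDδ
    rw [hδ] at hcount
    refine le_trans (Finset.card_le_card fun φ hφ ↦ ?_) (hcount.trans (le_of_eq ?_))
    · rw [Finset.mem_filter, hBad, Finset.mem_filter] at hφ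
      rw [Finset.mem_filter]
      exact ⟨Finset.mem_univ _,
        exists_smallFactor_of_card_normalizedFactors hφ.1.2.2.1 (hW _ _ _) hφ.2⟩
    · simp only [hc34, hQ, hq, mul_assoc]
  -- Step 1: the weights
  have h1 : ∑ φ ∈ Bad, max 1 (m φ - 1) ≤
      ∑ φ ∈ Bad, (1 + ∑ j ∈ Finset.Ico 2 δ, if j + 1 ≤ m φ then 1 else 0) := by
    refine Finset.sum_le_sum fun φ hφ ↦ ?_
    have := max_one_sub_one_le_one_add_card (hmle φ hφ)
    rwa [Finset.card_filter] at this
  -- Step 2: exchange the sums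
  have h2 : ∑ φ ∈ Bad, (1 + ∑ j ∈ Finset.Ico 2 δ, if j + 1 ≤ m φ then 1 else 0) =
      Bad.card + ∑ j ∈ Finset.Ico 2 δ, g j := by
    rw [Finset.sum_add_distrib, Finset.sum_const, smul_eq_mul, mul_one, Finset.sum_comm]
    congr 1
    refine Finset.sum_congr rfl fun j _ ↦ ?_
    simp only [hg, Finset.card_filter]
  -- Step 3: split the range of `j` at `b = min (r + 1) δ`
  set b := min (r + 1) δ with hb
  have hb2 : 2 ≤ b := by rw [hb]; exact le_min (by omega) hδ2
  have hbδ : b ≤ δ := min_le_right _ _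
  have h3 : ∑ j ∈ Finset.Ico 2 δ, g j = ∑ j ∈ Finset.Ico 2 b, g j + ∑ j ∈ Finset.Ico b δ, g j := by
    rw [← Finset.sum_union (Finset.Ico_disjoint_Ico_consecutive 2 b δ),
      Finset.Ico_union_Ico_eq_Ico hb2 hbδ]
  have h4 : ∑ j ∈ Finset.Ico 2 b, g j ≤ (r - 1) * Bad.card := by
    calc ∑ j ∈ Finset.Ico 2 b, g j ≤ ∑ _j ∈ Finset.Ico 2 b, Bad.card :=
          Finset.sum_le_sum fun j _ ↦ hgle j
      _ = (b - 2) * Bad.card := by rw [Finset.sum_const, Nat.card_Ico, smul_eq_mul]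
      _ ≤ (r - 1) * Bad.card := Nat.mul_le_mul_right _ (by omega)
  have h5 : ∑ j ∈ Finset.Ico b δ, g j ≤ ∑ j ∈ Finset.Ico (r + 1) δ, c34 j * Q := by
    have hsub : Finset.Ico b δ ⊆ Finset.Ico (r + 1) δ := by
      intro j hj
      rw [Finset.mem_Ico] at hj ⊢
      omega
    calc ∑ j ∈ Finset.Ico b δ, g j ≤ ∑ j ∈ Finset.Ico (r + 1) δ, g j :=
          Finset.sum_le_sum_of_subset_of_nonneg hsub fun _ _ _ ↦ Nat.zero_le _
      _ ≤ ∑ j ∈ Finset.Ico (r + 1) δ, c34 j * Q := Finset.sum_le_sum fun j hj ↦ by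
          rw [Finset.mem_Ico] at hj
          exact hg34 j (by omega)
  -- assemble
  calc ∑ φ ∈ Bad, max 1 (m φ - 1)
      ≤ ∑ φ ∈ Bad, (1 + ∑ j ∈ Finset.Ico 2 δ, if j + 1 ≤ m φ then 1 else 0) := h1
    _ = Bad.card + (∑ j ∈ Finset.Ico 2 b, g j + ∑ j ∈ Finset.Ico b δ, g j) := by rw [h2, h3]
    _ ≤ Bad.card + ((r - 1) * Bad.card + ∑ j ∈ Finset.Ico (r + 1) δ, c34 j * Q) :=
        Nat.add_le_add_left (Nat.add_le_add h4 h5) _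
    _ = r * Bad.card + ∑ j ∈ Finset.Ico (r + 1) δ, c34 j * Q := by
        obtain ⟨r', rfl⟩ : ∃ r', r = r' + 1 := ⟨r - 1, by omega⟩
        rw [Nat.add_sub_cancel]; ring
    _ ≤ r * (c32 * Q) + ∑ j ∈ Finset.Ico (r + 1) δ, c34 j * Q :=
        Nat.add_le_add_right (Nat.mul_le_mul_left _ hBadcard) _
    _ = (r * c32 + ∑ j ∈ Finset.Ico (r + 1) δ, c34 j) * Q := by
        rw [← Finset.sum_mul, ← mul_assoc, ← add_mul]
    _ = _ := by rw [hQ, hq, hc32, hc34]; ring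

end Count

/-! ### Numerics: telescoping sums -/

section Numerics

/-- `∑_{a ≤ j < b} (j+1)^{-3} ≤ 1/(2a(a+1)) - 1/(2b(b+1))` (`1 ≤ a ≤ b`), since
`(j+1)^{-3} ≤ 1/(j(j+1)(j+2))`. [folklore] -/
theorem sum_Ico_inv_cube_le {a : ℕ} (ha : 1 ≤ a) {b : ℕ} (hab : a ≤ b) :
    ∑ j ∈ Finset.Ico a b, (1 : ℝ) / ((j : ℝ) + 1) ^ 3 ≤
      1 / (2 * (a : ℝ) * ((a : ℝ) + 1)) - 1 / (2 * (b : ℝ) * ((b : ℝ) + 1)) := by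
  induction b, hab using Nat.le_induction with
  | base => simp
  | succ b hb ih =>
    rw [Finset.sum_Ico_succ_top hb]
    have hb1 : (1 : ℝ) ≤ b := by exact_mod_cast ha.trans hb
    have hb0 : (b : ℝ) ≠ 0 := by positivity
    have e1 : (1 : ℝ) / (2 * (b : ℝ) * ((b : ℝ) + 1)) - 1 / (2 * ((b : ℝ) + 1) * ((b : ℝ) + 1 + 1)) =
        1 / ((b : ℝ) * ((b : ℝ) + 1) * ((b : ℝ) + 2)) := by
      field_simp
      ring
    have e2 : (1 : ℝ) / ((b : ℝ) + 1) ^ 3 ≤ 1 / ((b : ℝ) * ((b : ℝ) + 1) * ((b : ℝ) + 2)) :=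
      one_div_le_one_div_of_le (by positivity) (by nlinarith)
    push_cast
    linarith

/-- `∑_{a ≤ j < b} (j+1)^{-2} ≤ 1/a - 1/b` (`1 ≤ a ≤ b`), since `(j+1)^{-2} ≤ 1/(j(j+1))`.
[folklore] -/
theorem sum_Ico_inv_sq_le {a : ℕ} (ha : 1 ≤ a) {b : ℕ} (hab : a ≤ b) :
    ∑ j ∈ Finset.Ico a b, (1 : ℝ) / ((j : ℝ) + 1) ^ 2 ≤ 1 / (a : ℝ) - 1 / (b : ℝ) := by
  induction b, hab using Nat.le_induction with
  | base => simp
  | succ b hb ih =>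
    rw [Finset.sum_Ico_succ_top hb]
    have hb1 : (1 : ℝ) ≤ b := by exact_mod_cast ha.trans hb
    have hb0 : (b : ℝ) ≠ 0 := by positivity
    have e1 : (1 : ℝ) / (b : ℝ) - 1 / ((b : ℝ) + 1) = 1 / ((b : ℝ) * ((b : ℝ) + 1)) := by
      field_simp
      ring
    have e2 : (1 : ℝ) / ((b : ℝ) + 1) ^ 2 ≤ 1 / ((b : ℝ) * ((b : ℝ) + 1)) :=
      one_div_le_one_div_of_le (by positivity) (by nlinarith)
    push_cast
    linarith

/-- **The Cor. 3.4 constant at `D = ⌊δ/(j+1)⌋`:**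
`c₃₄(δ, D) ≤ 2δ² + 1 + 2δ⁵/(j+1)³ + 6δ⁴/(j+1)²` (`D(D+1)² ≤ D³ + 3D²`, `D ≤ δ/(j+1)`).
[cite: CafureMatera2006, (11)] -/
theorem cast_c34_le {δ : ℕ} (hδ1 : 1 ≤ δ) (j : ℕ) :
    ((((δ + 1) + (δ + (δ - 1)) * δ +
        δ * ((δ / (j + 1) + 1) ^ 2 * (2 * (δ / (j + 1)) * δ))) : ℕ) : ℝ) ≤
      (2 * (δ : ℝ) ^ 2 + 1) + 2 * (δ : ℝ) ^ 5 * (1 / ((j : ℝ) + 1) ^ 3) +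
        6 * (δ : ℝ) ^ 4 * (1 / ((j : ℝ) + 1) ^ 2) := by
  set D := δ / (j + 1) with hD
  have hD0 : (0 : ℝ) ≤ D := Nat.cast_nonneg _
  have hDle : (D : ℝ) ≤ δ / ((j : ℝ) + 1) := by
    have := Nat.cast_div_le (m := δ) (n := j + 1) (α := ℝ)
    push_cast at this
    exact this
  have hDsq : (D : ℝ) ≤ (D : ℝ) ^ 2 := by
    rcases Nat.eq_zero_or_pos D with h | h
    · simp [h]
    · have : (1 : ℝ) ≤ D := by exact_mod_cast h
      nlinarith
  have hcast : ((((δ + 1) + (δ + (δ - 1)) * δ + δ * ((D + 1) ^ 2 * (2 * D * δ))) : ℕ) : ℝ) =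
      (2 * (δ : ℝ) ^ 2 + 1) + 2 * (δ : ℝ) ^ 2 * ((D : ℝ) * ((D : ℝ) + 1) ^ 2) := by
    push_cast [Nat.cast_sub hδ1]
    ring
  rw [hcast]
  have h3 : (D : ℝ) ^ 3 ≤ (δ : ℝ) ^ 3 * (1 / ((j : ℝ) + 1) ^ 3) := by
    rw [mul_one_div, ← div_pow]
    exact pow_le_pow_left₀ hD0 hDle 3
  have h2 : (D : ℝ) ^ 2 ≤ (δ : ℝ) ^ 2 * (1 / ((j : ℝ) + 1) ^ 2) := by
    rw [mul_one_div, ← div_pow]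
    exact pow_le_pow_left₀ hD0 hDle 2
  have hδ0 : (0 : ℝ) ≤ 2 * (δ : ℝ) ^ 2 := by positivity
  have hDD : (D : ℝ) * ((D : ℝ) + 1) ^ 2 ≤ (D : ℝ) ^ 3 + 3 * (D : ℝ) ^ 2 := by nlinarith
  have := mul_le_mul_of_nonneg_left (hDD.trans (add_le_add h3 (mul_le_mul_of_nonneg_left h2
    (by norm_num : (0 : ℝ) ≤ 3)))) hδ0
  nlinarith [this]

/-- **Summing the Cor. 3.4 counts:** for `r ≥ 1`,
`∑_{j=r+1}^{δ-1} c₃₄(δ, ⌊δ/(j+1)⌋) ≤ δ(2δ² + 1) + 2δ²(δ³/(2(r+1)²) + 3δ²/(r+1))`.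
[cite: CafureMatera2006, (14)] -/
theorem sum_c34_le {δ r : ℕ} (hδ1 : 1 ≤ δ) (hr : 1 ≤ r) :
    ((∑ j ∈ Finset.Ico (r + 1) δ, ((δ + 1) + (δ + (δ - 1)) * δ +
        δ * ((δ / (j + 1) + 1) ^ 2 * (2 * (δ / (j + 1)) * δ))) : ℕ) : ℝ) ≤
      (δ : ℝ) * (2 * (δ : ℝ) ^ 2 + 1) +
        2 * (δ : ℝ) ^ 2 * ((δ : ℝ) ^ 3 / (2 * ((r : ℝ) + 1) ^ 2) +
          3 * (δ : ℝ) ^ 2 / ((r : ℝ) + 1)) := by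
  have hδ0 : (0 : ℝ) ≤ δ := Nat.cast_nonneg _
  have hr0 : (0 : ℝ) < (r : ℝ) + 1 := by positivity
  rcases le_or_gt δ (r + 1) with hle | hlt
  · rw [Finset.Ico_eq_empty_of_le hle, Finset.sum_empty, Nat.cast_zero]
    positivity
  rw [Nat.cast_sum]
  set S3 := ∑ j ∈ Finset.Ico (r + 1) δ, (1 : ℝ) / ((j : ℝ) + 1) ^ 3 with hS3
  set S2 := ∑ j ∈ Finset.Ico (r + 1) δ, (1 : ℝ) / ((j : ℝ) + 1) ^ 2 with hS2
  have hsum : ∑ j ∈ Finset.Ico (r + 1) δ, ((((δ + 1) + (δ + (δ - 1)) * δ +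
      δ * ((δ / (j + 1) + 1) ^ 2 * (2 * (δ / (j + 1)) * δ))) : ℕ) : ℝ) ≤
      ((Finset.Ico (r + 1) δ).card : ℝ) * (2 * (δ : ℝ) ^ 2 + 1) + 2 * (δ : ℝ) ^ 5 * S3 +
        6 * (δ : ℝ) ^ 4 * S2 := by
    calc _ ≤ ∑ j ∈ Finset.Ico (r + 1) δ, ((2 * (δ : ℝ) ^ 2 + 1) +
          2 * (δ : ℝ) ^ 5 * (1 / ((j : ℝ) + 1) ^ 3) + 6 * (δ : ℝ) ^ 4 * (1 / ((j : ℝ) + 1) ^ 2)) :=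
          Finset.sum_le_sum fun j _ ↦ cast_c34_le hδ1 j
      _ = _ := by
          rw [Finset.sum_add_distrib, Finset.sum_add_distrib, Finset.sum_const, nsmul_eq_mul,
            hS3, hS2, Finset.mul_sum, Finset.mul_sum]
  have hcard : ((Finset.Ico (r + 1) δ).card : ℝ) ≤ δ := by
    rw [Nat.card_Ico]
    exact_mod_cast Nat.sub_le δ (r + 1)
  have h3 : S3 ≤ 1 / (2 * ((r : ℝ) + 1) ^ 2) := by
    have h := sum_Ico_inv_cube_le (a := r + 1) (by omega) hlt.le
    push_cast at h
    have hpos : (0 : ℝ) < 1 / (2 * (δ : ℝ) * ((δ : ℝ) + 1)) := by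
      have : (1 : ℝ) ≤ δ := by exact_mod_cast hδ1
      positivity
    have hle : (1 : ℝ) / (2 * ((r : ℝ) + 1) * ((r : ℝ) + 1 + 1)) ≤ 1 / (2 * ((r : ℝ) + 1) ^ 2) :=
      one_div_le_one_div_of_le (by positivity) (by nlinarith)
    rw [hS3]
    linarith
  have h2 : S2 ≤ 1 / ((r : ℝ) + 1) := by
    have h := sum_Ico_inv_sq_le (a := r + 1) (by omega) hlt.le
    push_cast at h
    have hpos : (0 : ℝ) < 1 / (δ : ℝ) := by
      have : (1 : ℝ) ≤ δ := by exact_mod_cast hδ1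
      positivity
    rw [hS2]
    linarith
  have hA : (0 : ℝ) ≤ 2 * (δ : ℝ) ^ 2 + 1 := by positivity
  have hB : (0 : ℝ) ≤ 2 * (δ : ℝ) ^ 5 := by positivity
  have hC : (0 : ℝ) ≤ 6 * (δ : ℝ) ^ 4 := by positivity
  have e : (δ : ℝ) * (2 * (δ : ℝ) ^ 2 + 1) +
      2 * (δ : ℝ) ^ 2 * ((δ : ℝ) ^ 3 / (2 * ((r : ℝ) + 1) ^ 2) + 3 * (δ : ℝ) ^ 2 / ((r : ℝ) + 1)) =
      (δ : ℝ) * (2 * (δ : ℝ) ^ 2 + 1) + 2 * (δ : ℝ) ^ 5 * (1 / (2 * ((r : ℝ) + 1) ^ 2)) +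
        6 * (δ : ℝ) ^ 4 * (1 / ((r : ℝ) + 1)) := by ring
  rw [e]
  have := mul_le_mul_of_nonneg_right hcard hA
  have := mul_le_mul_of_nonneg_left h3 hB
  have := mul_le_mul_of_nonneg_left h2 hC
  linarith

/-- `3y¹³ + 6y¹¹ + 3y⁹ + 2y⁷ + y⁶ + y³ + y + 1 ≤ 5y¹³` for `y ≥ 2`. [folklore] -/
theorem poly_bound_prop41 {y : ℝ} (hy : 2 ≤ y) :
    3 * y ^ 13 + 6 * y ^ 11 + 3 * y ^ 9 + 2 * y ^ 7 + y ^ 6 + y ^ 3 + y + 1 ≤ 5 * y ^ 13 := by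
  have hy0 : 0 ≤ y := by linarith
  have hy2 : 4 ≤ y ^ 2 := by nlinarith
  have h11 : 4 * y ^ 11 ≤ y ^ 13 := by
    calc 4 * y ^ 11 ≤ y ^ 2 * y ^ 11 := mul_le_mul_of_nonneg_right hy2 (by positivity)
      _ = y ^ 13 := by ring
  have h9 : 4 * y ^ 9 ≤ y ^ 11 := by
    calc 4 * y ^ 9 ≤ y ^ 2 * y ^ 9 := mul_le_mul_of_nonneg_right hy2 (by positivity)
      _ = y ^ 11 := by ring
  have h7 : 4 * y ^ 7 ≤ y ^ 9 := by
    calc 4 * y ^ 7 ≤ y ^ 2 * y ^ 7 := mul_le_mul_of_nonneg_right hy2 (by positivity)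
      _ = y ^ 9 := by ring
  have h6 : 2 * y ^ 6 ≤ y ^ 7 := by
    calc 2 * y ^ 6 ≤ y * y ^ 6 := mul_le_mul_of_nonneg_right hy (by positivity)
      _ = y ^ 7 := by ring
  have hy3 : 8 ≤ y ^ 3 := by nlinarith
  have h3 : 8 * y ^ 3 ≤ y ^ 6 := by
    calc 8 * y ^ 3 ≤ y ^ 3 * y ^ 3 := mul_le_mul_of_nonneg_right hy3 (by positivity)
      _ = y ^ 6 := by ring
  have h1 : 4 * y ≤ y ^ 3 := by
    calc 4 * y ≤ y ^ 2 * y := mul_le_mul_of_nonneg_right hy2 hy0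
      _ = y ^ 3 := by ring
  linarith

/-- **Parametrised Prop. 4.1, numerical part:** with `r = ⌊δ^{1/3}⌋` (the largest `r` with
`r³ ≤ δ`) and `T(δ, r) = r c₃₂(δ) + ∑_{j=r+1}^{δ-1} c₃₄(δ, ⌊δ/(j+1)⌋)`:
`δ³ + δ² + 1 + T(δ, r) ≤ 5 δ^{13/3}` for `δ ≥ 6`. For `δ ≥ 8` (`y = δ^{1/3} ≥ 2`,
`r ≤ y < r + 1`): `T ≤ 3y¹³ + 6y¹¹ + 2y⁹ + 2y⁷ + y³ + y - (δ³ + δ² + 1) + …`, precisely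
`δ³ + δ² + 1 + T ≤ 3y¹³ + 6y¹¹ + 3y⁹ + 2y⁷ + y⁶ + y³ + y + 1 ≤ 5y¹³`; `δ = 6, 7` by evaluation
(`T = 4901, 8385`). [cite: CafureMatera2006, Prop. 4.1 and (22)–(23)] -/
theorem numeric_prop41 {δ : ℕ} (hδ : 6 ≤ δ) :
    (δ : ℝ) ^ 3 + (δ : ℝ) ^ 2 + 1 +
      ((Nat.findGreatest (fun r ↦ r ^ 3 ≤ δ) δ *
          ((δ + 1) + (δ + (δ - 1)) * δ + δ ^ 2 * (2 * δ ^ 2 - δ)) +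
        ∑ j ∈ Finset.Ico (Nat.findGreatest (fun r ↦ r ^ 3 ≤ δ) δ + 1) δ,
          ((δ + 1) + (δ + (δ - 1)) * δ + δ * ((δ / (j + 1) + 1) ^ 2 * (2 * (δ / (j + 1)) * δ))) :
        ℕ) : ℝ) ≤ 5 * (δ : ℝ) ^ ((13 : ℝ) / 3) := by
  obtain ⟨r, hr⟩ : ∃ r, r = Nat.findGreatest (fun r ↦ r ^ 3 ≤ δ) δ := ⟨_, rfl⟩
  rw [← hr]
  have hδ1 : 1 ≤ δ := by omega
  have hr1 : 1 ≤ r := by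
    rw [hr]
    exact Nat.le_findGreatest hδ1 (by norm_num; omega)
  have hr3 : r ^ 3 ≤ δ := by
    rw [hr]
    exact Nat.findGreatest_spec (P := fun r ↦ r ^ 3 ≤ δ) hδ1 (by norm_num; omega)
  have hr3' : δ < (r + 1) ^ 3 := by
    by_contra h
    rw [not_lt] at h
    have hk : r + 1 ≤ δ := le_trans (Nat.le_self_pow (by norm_num) _) h
    have := Nat.findGreatest_is_greatest (P := fun r ↦ r ^ 3 ≤ δ) (k := r + 1)
      (by rw [← hr]; exact lt_add_one r) hk
    exact this h
  clear hr
  have hδ0 : (0 : ℝ) ≤ δ := Nat.cast_nonneg _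
  rcases lt_or_ge δ 8 with hδ8 | hδ8
  · -- `δ = 6, 7`: `r = 1`, evaluate
    have hr2 : r < 2 := by
      by_contra h
      rw [not_lt] at h
      have := Nat.pow_le_pow_left h 3
      omega
    obtain rfl : r = 1 := by omega
    clear hr1 hr2 hr3 hr3'
    obtain rfl | rfl : δ = 6 ∨ δ = 7 := by omega
    · have hx : (2354 : ℝ) ≤ (6 : ℝ) ^ ((13 : ℝ) / 3) :=
        le_rpow_thirteen_thirds (by norm_num) (by norm_num)
      have hT : (1 * ((6 + 1) + (6 + (6 - 1)) * 6 + 6 ^ 2 * (2 * 6 ^ 2 - 6)) +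
          ∑ j ∈ Finset.Ico (1 + 1) 6,
            ((6 + 1) + (6 + (6 - 1)) * 6 + 6 * ((6 / (j + 1) + 1) ^ 2 * (2 * (6 / (j + 1)) * 6))) :
          ℕ) = 4901 := by decide
      rw [hT]
      norm_num
      linarith
    · have hx : (4592 : ℝ) ≤ (7 : ℝ) ^ ((13 : ℝ) / 3) :=
        le_rpow_thirteen_thirds (by norm_num) (by norm_num)
      have hT : (1 * ((7 + 1) + (7 + (7 - 1)) * 7 + 7 ^ 2 * (2 * 7 ^ 2 - 7)) +
          ∑ j ∈ Finset.Ico (1 + 1) 7,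
            ((7 + 1) + (7 + (7 - 1)) * 7 + 7 * ((7 / (j + 1) + 1) ^ 2 * (2 * (7 / (j + 1)) * 7))) :
          ℕ) = 8385 := by decide
      rw [hT]
      norm_num
      linarith
  -- `δ ≥ 8`: `y = δ^{1/3} ≥ 2`, `r ≤ y < r + 1`
  set y : ℝ := (δ : ℝ) ^ ((1 : ℝ) / 3) with hy
  have hy0 : 0 ≤ y := Real.rpow_nonneg hδ0 _
  have hy3 : y ^ 3 = δ := by
    rw [hy, ← Real.rpow_natCast, ← Real.rpow_mul hδ0]
    norm_num
  have h13 : (δ : ℝ) ^ ((13 : ℝ) / 3) = y ^ 13 := by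
    rw [hy, ← Real.rpow_natCast, ← Real.rpow_mul hδ0]
    norm_num
  have hy2 : 2 ≤ y := by
    have h8 : (2 : ℝ) ^ 3 ≤ y ^ 3 := by
      rw [hy3]; exact_mod_cast hδ8
    exact le_of_pow_le_pow_left₀ (by norm_num) hy0 h8
  have hypos : 0 < y := by linarith
  have hry : (r : ℝ) ≤ y := by
    have h : (r : ℝ) ^ 3 ≤ y ^ 3 := by
      rw [hy3]; exact_mod_cast hr3
    exact le_of_pow_le_pow_left₀ (by norm_num) hy0 h
  have hyr : y < (r : ℝ) + 1 := by
    have h : y ^ 3 < ((r : ℝ) + 1) ^ 3 := by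
      rw [hy3]; exact_mod_cast hr3'
    exact lt_of_pow_lt_pow_left₀ 3 (by positivity) h
  -- the two constants
  have h2δ : δ ≤ 2 * δ ^ 2 := by nlinarith
  have hA : ((((δ + 1) + (δ + (δ - 1)) * δ + δ ^ 2 * (2 * δ ^ 2 - δ)) : ℕ) : ℝ) ≤
      2 * (δ : ℝ) ^ 4 + 2 * (δ : ℝ) ^ 2 + 1 := by
    have e : ((((δ + 1) + (δ + (δ - 1)) * δ + δ ^ 2 * (2 * δ ^ 2 - δ)) : ℕ) : ℝ) =
        2 * (δ : ℝ) ^ 4 - (δ : ℝ) ^ 3 + 2 * (δ : ℝ) ^ 2 + 1 := by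
      push_cast [Nat.cast_sub hδ1, Nat.cast_sub h2δ]
      ring
    rw [e]
    nlinarith [pow_nonneg hδ0 3]
  have hS := sum_c34_le (δ := δ) (r := r) hδ1 hr1
  -- replace `r` by `y`
  have hpos4 : (0 : ℝ) ≤ 2 * (δ : ℝ) ^ 4 + 2 * (δ : ℝ) ^ 2 + 1 := by positivity
  have h1' : (r : ℝ) * (2 * (δ : ℝ) ^ 4 + 2 * (δ : ℝ) ^ 2 + 1) ≤
      y * (2 * (δ : ℝ) ^ 4 + 2 * (δ : ℝ) ^ 2 + 1) := mul_le_mul_of_nonneg_right hry hpos4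
  have h2' : (δ : ℝ) ^ 3 / (2 * ((r : ℝ) + 1) ^ 2) ≤ (δ : ℝ) ^ 3 / (2 * y ^ 2) :=
    div_le_div_of_nonneg_left (by positivity) (by positivity) (by nlinarith)
  have h3' : 3 * (δ : ℝ) ^ 2 / ((r : ℝ) + 1) ≤ 3 * (δ : ℝ) ^ 2 / y :=
    div_le_div_of_nonneg_left (by positivity) hypos hyr.le
  have h2'' := mul_le_mul_of_nonneg_left (add_le_add h2' h3')
    (by positivity : (0 : ℝ) ≤ 2 * (δ : ℝ) ^ 2)
  have hrA := mul_le_mul_of_nonneg_left hA (Nat.cast_nonneg r)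
  -- everything in terms of `y`
  have hP : (δ : ℝ) ^ 3 + (δ : ℝ) ^ 2 + 1 + y * (2 * (δ : ℝ) ^ 4 + 2 * (δ : ℝ) ^ 2 + 1) +
      ((δ : ℝ) * (2 * (δ : ℝ) ^ 2 + 1) +
        2 * (δ : ℝ) ^ 2 * ((δ : ℝ) ^ 3 / (2 * y ^ 2) + 3 * (δ : ℝ) ^ 2 / y)) =
      3 * y ^ 13 + 6 * y ^ 11 + 3 * y ^ 9 + 2 * y ^ 7 + y ^ 6 + y ^ 3 + y + 1 := by
    rw [← hy3]
    field_simp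
    ring
  have hfin := poly_bound_prop41 hy2
  rw [h13]
  have hcast : (((r * ((δ + 1) + (δ + (δ - 1)) * δ + δ ^ 2 * (2 * δ ^ 2 - δ)) +
      ∑ j ∈ Finset.Ico (r + 1) δ,
        ((δ + 1) + (δ + (δ - 1)) * δ + δ * ((δ / (j + 1) + 1) ^ 2 * (2 * (δ / (j + 1)) * δ))) :
        ℕ) : ℝ)) =
      (r : ℝ) * ((((δ + 1) + (δ + (δ - 1)) * δ + δ ^ 2 * (2 * δ ^ 2 - δ)) : ℕ) : ℝ) +
        ((∑ j ∈ Finset.Ico (r + 1) δ, ((δ + 1) + (δ + (δ - 1)) * δ +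
          δ * ((δ / (j + 1) + 1) ^ 2 * (2 * (δ / (j + 1)) * δ))) : ℕ) : ℝ) := by
    rw [Nat.cast_add, Nat.cast_mul]
  rw [hcast]
  linarith [hP, hfin, h1', hrA, hS, h2'']

end Numerics

/-! ### Theorem 5.2 -/

section Final

/-- **Cafure–Matera (2006), Theorem 5.2** (binder form). For `K = 𝔽_q`, `f ∈ K[X₁, …, Xₙ]`
absolutely irreducible of degree `δ` and `N = #{x ∈ Kⁿ : f(x) = 0}`:
`|N - q^{n-1}| ≤ (δ - 1)(δ - 2) q^{n-3/2} + 5 δ^{13/3} q^{n-2}`.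
Proof: `δ ≤ 5` by `CafureMatera2006_thm52_of_totalDegree_le_five`; `δ ≥ 6` by
`CafureMatera2006_thm52_of_bad_le` with the weighted bad-plane count `sum_bad_weight_le_T`
(Cor. 3.2 + Cor. 3.4 parametrised, `r = ⌊δ^{1/3}⌋`) and `numeric_prop41`.
[cite: CafureMatera2006, Thm. 5.2] -/
theorem CafureMatera2006_thm52_holds' (K : Type) [Field K] [Fintype K] [DecidableEq K] (n : ℕ)
    (f : MvPolynomial (Fin n) K) (hf : IsAbsIrreducible f) :
    |(rationalPointCount f : ℝ) - (Fintype.card K : ℝ) ^ ((n : ℝ) - 1)| ≤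
      ((f.totalDegree : ℝ) - 1) * ((f.totalDegree : ℝ) - 2) *
          (Fintype.card K : ℝ) ^ ((n : ℝ) - 3 / 2) +
        5 * (f.totalDegree : ℝ) ^ ((13 : ℝ) / 3) * (Fintype.card K : ℝ) ^ ((n : ℝ) - 2) := by
  rcases le_or_gt f.totalDegree 5 with h5 | h5
  · exact CafureMatera2006_thm52_of_totalDegree_le_five K n f hf h5
  refine CafureMatera2006_thm52_of_bad_le (fun δ ↦ 6 ≤ δ)
    (fun δ ↦ ((Nat.findGreatest (fun r ↦ r ^ 3 ≤ δ) δ *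
          ((δ + 1) + (δ + (δ - 1)) * δ + δ ^ 2 * (2 * δ ^ 2 - δ)) +
        ∑ j ∈ Finset.Ico (Nat.findGreatest (fun r ↦ r ^ 3 ≤ δ) δ + 1) δ,
          ((δ + 1) + (δ + (δ - 1)) * δ + δ * ((δ / (j + 1) + 1) ^ 2 * (2 * (δ / (j + 1)) * δ))) :
        ℕ) : ℝ))
    (fun K _ _ n f hf hδ2 hn _ ↦ ?_) (fun δ _ h6 ↦ numeric_prop41 h6) K n f hf h5
  -- the bad-plane bound, with `q^{n-1} q^n q^n = q^{3n-1}`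
  have hr1 : 1 ≤ Nat.findGreatest (fun r ↦ r ^ 3 ≤ f.totalDegree) f.totalDegree :=
    Nat.le_findGreatest (by omega) (by norm_num; omega)
  have h := sum_bad_weight_le_T hf rfl hδ2 hr1
  rw [← Nat.cast_sum]
  refine (Nat.cast_le.2 h).trans (le_of_eq ?_)
  obtain ⟨m, rfl⟩ : ∃ m, n = m + 1 := ⟨n - 1, by omega⟩
  rw [show 3 * (m + 1) - 1 = 3 * m + 2 by omega, show m + 1 - 1 = m by omega, Nat.cast_mul,
    Nat.cast_mul, Nat.cast_mul, Nat.cast_pow, Nat.cast_pow]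
  ring

/-- **Cafure–Matera (2006), Theorem 5.2: PROVED** (discharge of the named fact
`CafureMatera2006_thm52`). [cite: CafureMatera2006, Thm. 5.2] -/
theorem CafureMatera2006_thm52_holds : CafureMatera2006_thm52 := by
  intro K _ _ _ n f hf
  exact CafureMatera2006_thm52_holds' K n f hf

end Final

end Literature.NumberTheory.DiophantineGeometry
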